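import Summits.QuantumFields.YangMills.Theorems.BalabanUVNodesN16AtRRec12
import Summits.QuantumFields.YangMills.Theorems.BalabanUVNodesN16LeafSlot
import HarnessLib

/-!
# Route «BalabanUVNodes», cluster K4 «SpineRates» — node N16 = NE3 AT THE STAGE-12 HOME FOR A CONSTANT NE3 LAYER: when the reading's NE3 component does not
# depend on the Stage-12 tuple, the couplings, the loop string or the run length — ONE object `o F : NE3Objects₁₁ N` per four-torus family (the cell's reading of
# record: node00-def-RR-1's `NE3Objects₁₁.ofRecord F N K K ℓ` at `K − k = 0`, dag-lead DEDUP after pub-ymgap INBOX l.13645) — `S_N16 (RRec₁₂ 𝔯)` IS «`N16At` at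
# `ne3OfRecord₁₁ F (o F)` for every family carrying a Stage-12 datum of record», and follows from the proviso + `PrintSlot` ∕ `LeafSlot` at ONE bundle per family

Cell `pub-ymgap`, seat `pub-ymgap-dag-n16-e` (R134 acceleration seat (a), strategy s2 = BY-NAME KNIT at the record; HUMAN RULING D-0062; chair R424 venue),
generation 2, file 9 (THEOREMS ONLY, 0 `def`, 0 `sorry`).  `bears_on: R4∕N16 · K3′ SpineGivenEndpointR12`.  Filed `--supports stmt-QuantumFields-19792 --as helper`.
Imports this seat's files 6 `BalabanUVNodesN16AtRRec12` (p466499: `s_N16_rRec₁₂_iff` via layer B, `covRoot_rRec₁₂`) and 7 `BalabanUVNodesN16LeafSlot` (p466652: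
`n16At_of_inEndRegime_leafSlot`).  Restates nothing; cites by name.

WHY (pub-ymgap INBOX l.13602 ∕ l.13645 ∕ dag-lead's confirmation, 2026-08-26).  N16's venue decl `N16At c` fixes ONE unit torus (`c.Nper`, `c.dom`) and ITSELF quantifies
every depth `k ≥ 1` beneath the same datum (the continuum direction), so the NE3 component of the rate reading of record must NOT vary with layer B's run length:
node00-def-RR-1 pins `(𝔯.lit F θ hP g₀ os).ne3 := fun _ ↦ NE3Objects₁₁.ofRecord F N K K ℓ_F` (`Nper = 2·L^m`, `dom` = all `2·L^m`-periodic `SU(N)` unit-lattice data —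
`K`-free by RR-1's `_succ` faces), and dag-n21-d's N21 modules read «`h16 : N16At (ne3OfRecord₁₁ F o)` at ONE object per family» (`…N21AtKeyedRateHomeConst`).  THIS FILE
states N16 at the Stage-12 home for exactly that shape — a reading CONSTANT in `(θ, hP, g₀, os, k)` with value `o F` — so the pin meets the home by ONE `N16At` per family.

CONTENT.
§1 `n16At_of_s_N16_rRec₁₂_constLayer` (under `S_N16 (RRec₁₂ 𝔯)`, `N16At (ne3OfRecord₁₁ F (o F))` at every family carrying a Stage-12 datum of record — what n21-d's
   `h16` binder receives), `s_N16_rRec₁₂_of_constLayer` (conversely, `N16At` at `o F` for every such family gives the stub), `s_N16_rRec₁₂_iff_of_constLayer`.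
§2 `s_N16_rRec₁₂_of_constLayer_printSlot` ∕ `s_N16_rRec₁₂_of_constLayer_leafSlot`: the stub from the proviso `InEndRegime` and the print-form ∕ leaf-form slot at
   ONE bundle `ne3OfRecord₁₁ F (o F)` per family (only families carrying a Stage-12 datum of record matter).

HONEST FRAMING.  Kernel bookkeeping by name; `InEndRegime`, `PrintSlot` ∕ `LeafSlot` (N05's leaf ∘ N07's `LeafH3sup`) stay HYPOTHESES; the constant layer is a pin
CONVENTION (RR-1's object, not yet in the tree as of this file), not a claim about Bałaban's objects; no inhabitant of `IsDatumOfRecord₁₂C` claimed (K0′ open);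
**N16 ∕ NE3 NOT discharged**; count-neutral; one finite four-torus at fixed ε — NOT ℝ⁴, NOT infinite volume, NOT OS, NOT a mass gap, NOT Clay.
-/

set_option autoImplicit false

open scoped BigOperators Matrix Matrix.Norms.L2Operator
open NormedSpace

namespace Summit.QuantumFields.YangMills.BalabanUVNodes.N16AtRRec12ConstLayer

open Literature.MathematicalPhysics.QuantumFieldTheory.Balaban1983to89
open Literature.MathematicalPhysics.QuantumFieldTheory.Balaban1983to89.T4Continuum (T4Family ULoop)
open Node00 (IsDatumOfRecord₁₂C Stage12Params NE3Objects₁₁)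
open Summit.QuantumFields.BalabanUV.T4Continuum
open YMDAG.UVSplit (Datum NE3Carriers RateCarriers RateRecordPred N16At S_N16 ne3OfRecord₁₁ RateReading₁₂ RRec₁₂ s_N16_rRec₁₂_iff)
open Summit.QuantumFields.YangMills.BalabanUVNodes.N16Regime (PrintSlot InEndRegime n16At_of_inEndRegime_printSlot)
open Summit.QuantumFields.YangMills.BalabanUVNodes.N16LeafSlot (LeafSlot n16At_of_inEndRegime_leafSlot)

noncomputable section

variable {N : ℕ} [NeZero N] (𝔯 : RateReading₁₂ N) (o : T4Family → NE3Objects₁₁ N)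

/-! ## §1 The stub at a constant layer IS one `N16At` per family with a datum of record -/

/-- **UNDER THE STUB, `N16At` AT THE ONE OBJECT OF EVERY FAMILY CARRYING A STAGE-12 DATUM OF RECORD** — the binder `h16 : N16At (ne3OfRecord₁₁ F o)` of dag-n21-d's
constant-layer N21 modules, read off `S_N16 (RRec₁₂ 𝔯)` for a reading whose NE3 component is constantly `o F`. [folklore] -/
theorem n16At_of_s_N16_rRec₁₂_constLayer
    (hconst : ∀ (F : T4Family) (θ : Stage12Params F N) (hP : θ.Provisos₁₂ F N) (g₀ : ℕ → ℝ) (os : List (ULoop F)) (k : ℕ), (𝔯.lit F θ hP g₀ os).ne3 k = o F)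
    (hS : S_N16 (RRec₁₂ 𝔯)) (F : T4Family) {D : Datum F N} (hD : IsDatumOfRecord₁₂C F N D) : N16At (ne3OfRecord₁₁ F (o F)) := by
  have h := (s_N16_rRec₁₂_iff 𝔯).1 hS F D hD (fun _ => 0) [] 0
  rwa [hconst] at h

/-- **`N16At` AT THE ONE OBJECT OF EVERY FAMILY CARRYING A STAGE-12 DATUM OF RECORD GIVES THE STUB** for a constant-layer reading. [folklore] -/
theorem s_N16_rRec₁₂_of_constLayer
    (hconst : ∀ (F : T4Family) (θ : Stage12Params F N) (hP : θ.Provisos₁₂ F N) (g₀ : ℕ → ℝ) (os : List (ULoop F)) (k : ℕ), (𝔯.lit F θ hP g₀ os).ne3 k = o F)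
    (h16 : ∀ (F : T4Family), (∃ D : Datum F N, IsDatumOfRecord₁₂C F N D) → N16At (ne3OfRecord₁₁ F (o F))) :
    S_N16 (RRec₁₂ 𝔯) :=
  (s_N16_rRec₁₂_iff 𝔯).2 fun F D hD g₀ os k => by
    rw [hconst]
    exact h16 F ⟨D, hD⟩

/-- **`S_N16 (RRec₁₂ 𝔯)` IS «`N16At (ne3OfRecord₁₁ F (o F))` for every family carrying a Stage-12 datum of record»** for a constant-layer reading. [folklore] -/
theorem s_N16_rRec₁₂_iff_of_constLayer
    (hconst : ∀ (F : T4Family) (θ : Stage12Params F N) (hP : θ.Provisos₁₂ F N) (g₀ : ℕ → ℝ) (os : List (ULoop F)) (k : ℕ), (𝔯.lit F θ hP g₀ os).ne3 k = o F) :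
    S_N16 (RRec₁₂ 𝔯) ↔ ∀ (F : T4Family), (∃ D : Datum F N, IsDatumOfRecord₁₂C F N D) → N16At (ne3OfRecord₁₁ F (o F)) :=
  ⟨fun hS F ⟨_, hD⟩ => n16At_of_s_N16_rRec₁₂_constLayer 𝔯 o hconst hS F hD, s_N16_rRec₁₂_of_constLayer 𝔯 o hconst⟩

/-! ## §2 The stub from the proviso and the slot at ONE bundle per family -/

/-- **THE KNIT AT A CONSTANT LAYER, PRINT FORM**: for a constant-layer reading, the proviso `InEndRegime` and the print-form slot `PrintSlot` at the ONE bundle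
`ne3OfRecord₁₁ F (o F)` of every family carrying a Stage-12 datum of record give `S_N16 (RRec₁₂ 𝔯)` (file 1's closer once per family). [folklore] -/
theorem s_N16_rRec₁₂_of_constLayer_printSlot
    (hconst : ∀ (F : T4Family) (θ : Stage12Params F N) (hP : θ.Provisos₁₂ F N) (g₀ : ℕ → ℝ) (os : List (ULoop F)) (k : ℕ), (𝔯.lit F θ hP g₀ os).ne3 k = o F)
    (h : ∀ (F : T4Family), (∃ D : Datum F N, IsDatumOfRecord₁₂C F N D) → InEndRegime (ne3OfRecord₁₁ F (o F)) ∧ PrintSlot (ne3OfRecord₁₁ F (o F))) :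
    S_N16 (RRec₁₂ 𝔯) :=
  s_N16_rRec₁₂_of_constLayer 𝔯 o hconst fun F hF => n16At_of_inEndRegime_printSlot (h F hF).1 (h F hF).2

/-- **THE KNIT AT A CONSTANT LAYER, LEAF FORM**: the same with the leaf-form slot `LeafSlot` (N05's typed leaf clauses on the univ sub-family of `zdGF3` + N07's
`LeafH3sup`; file 7's closer once per family). [folklore] -/
theorem s_N16_rRec₁₂_of_constLayer_leafSlot
    (hconst : ∀ (F : T4Family) (θ : Stage12Params F N) (hP : θ.Provisos₁₂ F N) (g₀ : ℕ → ℝ) (os : List (ULoop F)) (k : ℕ), (𝔯.lit F θ hP g₀ os).ne3 k = o F)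
    (h : ∀ (F : T4Family), (∃ D : Datum F N, IsDatumOfRecord₁₂C F N D) → InEndRegime (ne3OfRecord₁₁ F (o F)) ∧ LeafSlot (ne3OfRecord₁₁ F (o F))) :
    S_N16 (RRec₁₂ 𝔯) :=
  s_N16_rRec₁₂_of_constLayer 𝔯 o hconst fun F hF => n16At_of_inEndRegime_leafSlot (h F hF).1 (h F hF).2

end

end Summit.QuantumFields.YangMills.BalabanUVNodes.N16AtRRec12ConstLayer
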